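import Mathlib
import HarnessLib
import Literature.Analysis.FluidPDE.AxisymHouLiVariables
import Summits.NavierStokesRegularity.NavierStokesRegularity.Theorems.PoloidalWindowDoorPoloidalWindowRigidityZShockSlopeFunctionConnected

/-!
# Crux K2 `PoloidalWindowRigidity` (stmt-NavierStokesRegularity-19708), line `z_shock` — THE AUTONOMOUS HEIGHT-EVOLUTION EQUATION ON THE
# SLICE: `∂_z²w + divₕ(G(w) ∇ₕw) = 0` on every connected non-degenerate region (the object of rung R3)

`--supports stmt-NavierStokesRegularity-19708 --as helper` (leafhand-ns-poloidalwindowdoor-2 g0, 2026-08-31).  **No stub and no summit is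
closed by this file; Navier–Stokes regularity is NOT proved here.**

The line's lever (card `Lines/z_shock.md` §Idea, refuter K-48) reads each slice of an autonomous-column class profile as a trajectory of the
quasilinear wave equation IN THE HEIGHT, `w_zz + Δₕ[𝒢(w)] = 0` (`w = v₂`, `𝒢' = G` the slope function): divergence-freeness gives
`w_z = −divₕ vₕ`, and the slope law `∂_z vₕ = G(w)∇ₕw` turns `w_zz = −divₕ ∂_z vₕ` into `−divₕ(G(w)∇ₕw) = −(G(w)Δₕw + G'(w)|∇ₕw|²)`.
With L0 in the tree (one real-analytic `G` on every connected component of `{∇ₕv₂ ≠ 0}`, `…ZShockSlopeFunctionConnected`), this file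
states that equation as a kernel-checked identity:

* `heightEvolution_of_slope_function` — class-free: `f : ℝ³ → ℝ³` real-analytic and divergence-free, `∂_z f_b = G(f₂)·∂_b f₂` (`b = 0,1`)
  on an open `U` with `G` differentiable at the values ⇒ at every `x ∈ U`
  `∂₂∂₂f₂ = −( G(f₂)·(∂₀∂₀f₂ + ∂₁∂₁f₂) + G'(f₂)·((∂₀f₂)² + (∂₁f₂)²) )`
  (Schwarz for the `C²` field, product and chain rules; second derivatives in the stubs' nested form);
* `heightEvolution_of_class_autonomy` — class entry: binders of `stub_zShockThickAut` (Type-I rate, continuity, Oseen identity,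
  divergence-free, poloidal) + the LOCAL autonomy clause at `z₀` ⇒ on every open connected `Ω ⊆ {∇ₕv₂(t₀,·) ≠ 0}` of the slice there is ONE
  `G`, real-analytic at the values, such that the slice satisfies the slope law AND the autonomous height-evolution equation with `G' = deriv G`
  at every point of `Ω`.

So the deciding stub's core R3 now has its input typed in the tree: a bounded entire real-analytic `w = v₂(t₀,·)` solving, on each component
of its non-degenerate set, an AUTONOMOUS quasilinear second-order equation in the height whose nonlinearity `G` is the (analytic) slope
function; THICK = `G' ≠ 0`, hyperbolic = `G < 0`.  R3 itself (two-sided eternal rigidity; XL, not in print) is untouched.  presearch: the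
equation is the card's/K-48's; no tree statement of it for the autonomous (non-(TH)) column existed (the (TH) case `∂₂²v₂ = −μΔₕv₂` is
`…TimeHeightShearLinearSlice.plane_wave_identity`). [folklore]
-/

noncomputable section

namespace Summit.NavierStokesRegularity.NavierStokesRegularity.Theorems.PoloidalWindowDoorPoloidalWindowRigidityZShockHeightEvolution

-- the problem directory repeats the summit name (`NavierStokesRegularity/NavierStokesRegularity`)
set_option linter.dupNamespace false

open Set Filter Topology Function
open Literature.Analysis Literature.Analysis.FluidPDE
open Summit.NavierStokesRegularity.NavierStokesRegularity.Theorems.PoloidalWindowDoorPoloidalWindowRigidityZShockSlopeFunctionConnected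
open Summit.NavierStokesRegularity.NavierStokesRegularity.Theorems.PoloidalWindowDoorPoloidalWindowRigidityHorizontalSourceGauge
  (analyticOnNhd_fderiv_apply_coord)
open Summit.NavierStokesRegularity.NavierStokesRegularity.Theorems.PoloidalWindowDoorPoloidalWindowRigidityZShockAutonomyGlobal
  (analyticOnNhd_coord)

/-- **The autonomous height-evolution equation from divergence-freeness and a slope function.**  Let `f : ℝ³ → ℝ³` be real-analytic and
divergence-free, and suppose that on an open set `U` the vertical shear of the horizontal components is a slope function of the height
component, `∂_z f_b = G(f₂)·∂_b f₂` (`b = 0, 1`), with `G` differentiable at the values (`G'`).  Then at every `x ∈ U`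
`∂₂∂₂f₂ = −( G(f₂)(∂₀∂₀f₂ + ∂₁∂₁f₂) + G'(f₂)((∂₀f₂)² + (∂₁f₂)²) )`, i.e. `w_zz + divₕ(G(w)∇ₕw) = 0`. [folklore] -/
theorem heightEvolution_of_slope_function {f : EuclideanSpace ℝ (Fin 3) → EuclideanSpace ℝ (Fin 3)}
    (hf : AnalyticOnNhd ℝ f univ) (hdiv : VectorCalculus.IsDivFree f) {G G' : ℝ → ℝ}
    {U : Set (EuclideanSpace ℝ (Fin 3))} (hU : IsOpen U)
    (hG : ∀ y ∈ U, HasDerivAt G (G' (f y 2)) (f y 2))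
    (hslope : ∀ y ∈ U, ∀ b : Fin 3, b ≠ 2 →
      fderiv ℝ f y (EuclideanSpace.single 2 1) b = G (f y 2) * fderiv ℝ f y (EuclideanSpace.single b 1) 2)
    {x : EuclideanSpace ℝ (Fin 3)} (hx : x ∈ U) :
    fderiv ℝ (fun y => fderiv ℝ f y (EuclideanSpace.single 2 1) 2) x (EuclideanSpace.single 2 1) =
      -(G (f x 2) * (fderiv ℝ (fun y => fderiv ℝ f y (EuclideanSpace.single 0 1) 2) x (EuclideanSpace.single 0 1) +
            fderiv ℝ (fun y => fderiv ℝ f y (EuclideanSpace.single 1 1) 2) x (EuclideanSpace.single 1 1)) +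
        G' (f x 2) * (fderiv ℝ f x (EuclideanSpace.single 0 1) 2 ^ 2 + fderiv ℝ f x (EuclideanSpace.single 1 1) 2 ^ 2)) := by
  -- smoothness bookkeeping
  have hf2 : ContDiff ℝ 2 f := contDiff_iff_contDiffAt.2 fun y => (hf y (mem_univ _)).contDiffAt
  have hdf : ∀ y, DifferentiableAt ℝ f y := fun y => (hf y (mem_univ _)).differentiableAt
  have hD : ∀ (u : EuclideanSpace ℝ (Fin 3)) (i : Fin 3), Differentiable ℝ fun y => fderiv ℝ f y u i :=
    fun u i y => (analyticOnNhd_fderiv_apply_coord hf u i y (mem_univ _)).differentiableAt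
  have hDv : ∀ u : EuclideanSpace ℝ (Fin 3), Differentiable ℝ fun y => fderiv ℝ f y u := by
    intro u
    have h1 : ContDiff ℝ 1 (fderiv ℝ f) := hf2.fderiv_right (m := 1) (by norm_num)
    exact (h1.differentiable one_ne_zero).clm_apply (differentiable_const u)
  have hw : Differentiable ℝ fun y => f y 2 := fun y => (analyticOnNhd_coord hf 2 y (mem_univ _)).differentiableAt
  -- notation for the basis vectors
  set e0 : EuclideanSpace ℝ (Fin 3) := EuclideanSpace.single 0 1 with he0
  set e1 : EuclideanSpace ℝ (Fin 3) := EuclideanSpace.single 1 1 with he1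
  set e2 : EuclideanSpace ℝ (Fin 3) := EuclideanSpace.single 2 1 with he2
  -- divergence in coordinates, differentiated along `e2`
  have hd3 : (fun y => fderiv ℝ f y e0 0 + fderiv ℝ f y e1 1 + fderiv ℝ f y e2 2) = fun _ => (0 : ℝ) := by
    funext y
    rw [← divergence_eq_sum_three]
    exact hdiv y
  have hsum : fderiv ℝ (fun y => fderiv ℝ f y e0 0) x e2 + fderiv ℝ (fun y => fderiv ℝ f y e1 1) x e2 +
      fderiv ℝ (fun y => fderiv ℝ f y e2 2) x e2 = 0 := by
    have hS : HasFDerivAt (fun y => fderiv ℝ f y e0 0 + fderiv ℝ f y e1 1 + fderiv ℝ f y e2 2)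
        (fderiv ℝ (fun y => fderiv ℝ f y e0 0) x + fderiv ℝ (fun y => fderiv ℝ f y e1 1) x +
          fderiv ℝ (fun y => fderiv ℝ f y e2 2) x) x :=
      ((hD e0 0 x).hasFDerivAt.add (hD e1 1 x).hasFDerivAt).add (hD e2 2 x).hasFDerivAt
    rw [hd3] at hS
    have h0 := hS.unique (hasFDerivAt_const (0 : ℝ) x)
    have h1 := congrArg (fun L : EuclideanSpace ℝ (Fin 3) →L[ℝ] ℝ => L e2) h0
    simpa using h1
  -- Schwarz: `∂₂(∂_b f_b) = ∂_b(∂₂ f_b)`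
  have hschwarz : ∀ (b : Fin 3) (eb : EuclideanSpace ℝ (Fin 3)),
      fderiv ℝ (fun y => fderiv ℝ f y eb b) x e2 = fderiv ℝ (fun y => fderiv ℝ f y e2 b) x eb := by
    intro b eb
    rw [fderiv_apply_coord_vec3 (w := fun y => fderiv ℝ f y eb) (hDv eb x) b e2,
      fderiv_apply_coord_vec3 (w := fun y => fderiv ℝ f y e2) (hDv e2 x) b eb,
      fderiv_fderiv_apply_comm_vec hf2 x eb e2]
  -- the slope law differentiated along `e_b`
  have hterm : ∀ (b : Fin 3) (eb : EuclideanSpace ℝ (Fin 3)), b ≠ 2 → eb = EuclideanSpace.single b 1 →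
      fderiv ℝ (fun y => fderiv ℝ f y e2 b) x eb =
        G (f x 2) * fderiv ℝ (fun y => fderiv ℝ f y eb 2) x eb + G' (f x 2) * (fderiv ℝ f x eb 2) ^ 2 := by
    intro b eb hb heb
    -- the two functions agree near `x`
    have hEq : (fun y => fderiv ℝ f y e2 b) =ᶠ[𝓝 x] fun y => G (f y 2) * fderiv ℝ f y eb 2 := by
      filter_upwards [hU.mem_nhds hx] with y hy
      rw [heb]; exact hslope y hy b hb
    rw [hEq.fderiv_eq]
    -- product and chain rules
    have hc : HasFDerivAt (fun y => G (f y 2)) (G' (f x 2) • fderiv ℝ (fun y => f y 2) x) x :=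
      (hG x hx).comp_hasFDerivAt x (hw x).hasFDerivAt
    have hd : HasFDerivAt (fun y => fderiv ℝ f y eb 2) (fderiv ℝ (fun y => fderiv ℝ f y eb 2) x) x :=
      (hD eb 2 x).hasFDerivAt
    have hprod : HasFDerivAt (fun y => G (f y 2) * fderiv ℝ f y eb 2)
        (G (f x 2) • fderiv ℝ (fun y => fderiv ℝ f y eb 2) x +
          fderiv ℝ f x eb 2 • (G' (f x 2) • fderiv ℝ (fun y => f y 2) x)) x := hc.mul hd
    rw [hprod.fderiv]
    simp only [_root_.add_apply, _root_.smul_apply, smul_eq_mul]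
    rw [← fderiv_apply_coord_vec3 (hdf x) 2 eb]
    ring
  -- assemble
  have h0 := hterm 0 e0 (by decide) he0
  have h1 := hterm 1 e1 (by decide) he1
  rw [hschwarz 0 e0, h0, hschwarz 1 e1, h1] at hsum
  linear_combination hsum

/-- **Hyperbolic ⇔ negative slope function (pointwise algebra).**  If `N_b = c·D_b` for `b = 0, 1` and the stubs' hyperbolicity
quantity `N₀D₀ + N₁D₁` is negative, then `c < 0` (and `∇ₕw ≠ 0`): on the hyperbolic window the height-evolution
`w_zz + divₕ(G(w)∇ₕw) = 0` is a genuine wave equation `w_zz = divₕ(c²(w)∇ₕw)`, `c² = −G > 0`. [folklore] -/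
theorem slope_neg_of_hyperbolic {N₀ N₁ D₀ D₁ c : ℝ} (h0 : N₀ = c * D₀) (h1 : N₁ = c * D₁)
    (hhyp : N₀ * D₀ + N₁ * D₁ < 0) : c < 0 ∧ 0 < D₀ ^ 2 + D₁ ^ 2 := by
  have hsum : N₀ * D₀ + N₁ * D₁ = c * (D₀ ^ 2 + D₁ ^ 2) := by rw [h0, h1]; ring
  rw [hsum] at hhyp
  have hsq : 0 ≤ D₀ ^ 2 + D₁ ^ 2 := by positivity
  have hpos : 0 < D₀ ^ 2 + D₁ ^ 2 := by
    rcases hsq.lt_or_eq with h | h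
    · exact h
    · rw [← h, mul_zero] at hhyp; exact absurd hhyp (lt_irrefl 0)
  refine ⟨?_, hpos⟩
  by_contra hc
  push Not at hc
  have : 0 ≤ c * (D₀ ^ 2 + D₁ ^ 2) := mul_nonneg hc hsq
  linarith

/-- **The height-evolution equation for the route's class, on every connected non-degenerate region of the slice.**  Class binders of
`stub_zShockThickAut` + the stub's LOCAL autonomy clause at `z₀ ∈ W₁`: on every open connected `Ω ⊆ {∇ₕv₂(t₀,·) ≠ 0}` (`t₀ = z₀.1`) there is
ONE `G : ℝ → ℝ`, real-analytic at the values, such that on `Ω` the slice obeys the slope law `∂_z v_b = G(v₂)·∂_b v₂` (`b ≠ 2`) AND the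
autonomous quasilinear height-evolution equation
`∂₂∂₂v₂ = −( G(v₂)(∂₀∂₀v₂ + ∂₁∂₁v₂) + G'(v₂)((∂₀v₂)² + (∂₁v₂)²) )`, `G' = deriv G` — the input of rung R3. [folklore] -/
theorem heightEvolution_of_class_autonomy (C : ℝ) (v : ℝ → EuclideanSpace ℝ (Fin 3) → EuclideanSpace ℝ (Fin 3))
    (hrate : Literature.Analysis.FluidPDE.HasTypeITimeDecay C v)
    (hcont : ContinuousOn (Function.uncurry v) (Set.Iio (0 : ℝ) ×ˢ Set.univ))
    (hmild : ∀ s t : ℝ, s < t → t < 0 → ∀ x, v t x =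
      Literature.Analysis.UnboundedOperators.heatExtension (v s) (t - s) x -
        Literature.Analysis.FluidPDE.oseenDuhamel 1 s v v t x)
    (hdiv : ∀ t < 0, Literature.Analysis.FluidPDE.VectorCalculus.IsDivFree (v t))
    (hpol : ∀ s < 0, ∀ y, inner ℝ (Literature.Analysis.FluidPDE.curl (v s) y) (EuclideanSpace.single 2 1) = 0)
    {W₁ : Set (ℝ × EuclideanSpace ℝ (Fin 3))} (hW₁ : IsOpen W₁) (hW₁s : W₁ ⊆ Set.Iio (0 : ℝ) ×ˢ Set.univ)
    {z₀ : ℝ × EuclideanSpace ℝ (Fin 3)} (hz₀ : z₀ ∈ W₁) {g : ℝ → ℝ → ℝ}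
    (haut : ∀ z ∈ W₁, ∀ b : Fin 3, b ≠ 2 →
      fderiv ℝ (v z.1) z.2 (EuclideanSpace.single 2 1) b =
        g z.1 (v z.1 z.2 2) * fderiv ℝ (v z.1) z.2 (EuclideanSpace.single b 1) 2)
    {Ω : Set (EuclideanSpace ℝ (Fin 3))} (hΩ : IsPreconnected Ω) (hΩo : IsOpen Ω)
    (hΩnd : ∀ x ∈ Ω, fderiv ℝ (v z₀.1) x (EuclideanSpace.single 0 1) 2 ≠ 0 ∨
      fderiv ℝ (v z₀.1) x (EuclideanSpace.single 1 1) 2 ≠ 0) :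
    ∃ G : ℝ → ℝ, (∀ x ∈ Ω, AnalyticAt ℝ G (v z₀.1 x 2)) ∧
      (∀ x ∈ Ω, ∀ b : Fin 3, b ≠ 2 → fderiv ℝ (v z₀.1) x (EuclideanSpace.single 2 1) b =
        G (v z₀.1 x 2) * fderiv ℝ (v z₀.1) x (EuclideanSpace.single b 1) 2) ∧
      ∀ x ∈ Ω, fderiv ℝ (fun y => fderiv ℝ (v z₀.1) y (EuclideanSpace.single 2 1) 2) x (EuclideanSpace.single 2 1) =
        -(G (v z₀.1 x 2) *
              (fderiv ℝ (fun y => fderiv ℝ (v z₀.1) y (EuclideanSpace.single 0 1) 2) x (EuclideanSpace.single 0 1) +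
                fderiv ℝ (fun y => fderiv ℝ (v z₀.1) y (EuclideanSpace.single 1 1) 2) x (EuclideanSpace.single 1 1)) +
            deriv G (v z₀.1 x 2) *
              (fderiv ℝ (v z₀.1) x (EuclideanSpace.single 0 1) 2 ^ 2 + fderiv ℝ (v z₀.1) x (EuclideanSpace.single 1 1) 2 ^ 2)) := by
  obtain ⟨G, hGA, hG⟩ := autonomy_on_connected_of_class_autonomy C v hrate hcont hmild hdiv hpol hW₁ hW₁s hz₀ haut hΩ hΩo hΩnd
  have ht₀ : z₀.1 < 0 := (Set.mem_prod.1 (hW₁s hz₀)).1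
  have hbdd : ∀ δ : ℝ, 0 < δ → ∃ B : ℝ, ∀ t < -δ, ∀ y : EuclideanSpace ℝ (Fin 3), ‖v t y‖ ≤ B := by
    intro δ hδ
    refine ⟨|C| / Real.sqrt δ, fun t ht y => ?_⟩
    have hδt : δ ≤ -t := by linarith
    have hsq : Real.sqrt δ ≤ Real.sqrt (-t) := Real.sqrt_le_sqrt hδt
    have hsqpos : 0 < Real.sqrt δ := Real.sqrt_pos.2 hδ
    calc ‖v t y‖ ≤ C / Real.sqrt (-t) := hrate t (by linarith) y
      _ ≤ |C| / Real.sqrt (-t) := by gcongr; exact le_abs_self C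
      _ ≤ |C| / Real.sqrt δ := by gcongr
  have han : AnalyticOnNhd ℝ (v z₀.1) univ :=
    Literature.Analysis.NavierStokesZoomKit.LocalSineTubeDoorProfileAlignedWindowRigidityAncient.analyticOnNhd_slice
      hcont hbdd hmild ht₀
  refine ⟨G, hGA, hG, fun x hx => ?_⟩
  exact heightEvolution_of_slope_function han (hdiv z₀.1 ht₀) hΩo
    (fun y hy => (hGA y hy).differentiableAt.hasDerivAt) hG hx

end Summit.NavierStokesRegularity.NavierStokesRegularity.Theorems.PoloidalWindowDoorPoloidalWindowRigidityZShockHeightEvolution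

end
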